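import Literature.Geometry.Lorentzian.CoordShrinkerIdentities
import Literature.Geometry.Lorentzian.CoordPinchingMinimum
import Mathlib.Analysis.ODE.ExistUnique
import HarnessLib

/-!
# Integral curves of a parallel unit null field of a gradient soliton

For metric components `G` (the `MetricCoord` layer) and a smooth field `v` on `V` which is
PARALLEL (`Dv(X) + Γ(X, v) = 0`, the conclusion of `CoordNullRicciParallel.lean`), unit and null for
`Ric` on a gradient soliton `Ric + Hess f = λG`:

* `hasDerivAt_field_comp_of_parallel` — an integral curve `γ' = v(γ)` is a GEODESIC:
  `(v∘γ)' = −Γ(γ', γ')`;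
* `hasDerivAt_scalAt_comp_null_curve`, `hasDerivAt_fderiv_comp_null_curve` — along it
  `(S∘γ)' = 0` and `(f∘γ)'' = λ` (`dS = 2Ric(∇f,·)` and `Hess f(v,v) = λ` from the soliton equation
  with `Ric(v,·) = 0`, `G(v,v) = 1`);
* **`exists_null_geodesic_scalAt_const_fderiv_affine`** — through every point of `V` there is such a
  curve on an interval `(−ε, ε)` (Picard–Lindelöf), along which `S` is constant and `df(v)` is
  affine with slope `λ`: the cylinder signature `f = λt²/2 + ct + c'` along the null lines.

Everything is proved; no definitions are introduced.

## References

* P. Petersen, W. Wylie, Geom. Topol. 14 (2010), §3. [PetersenWylie2010]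
* B. O'Neill, *Semi-Riemannian geometry*, 1983, Ch. 3, Def. 3.49, Prop. 3.13. [ONeill1983]
-/

noncomputable section

set_option maxSynthPendingDepth 3

open Set Filter Metric Module
open scoped Topology ContDiff

namespace Literature.Geometry.Lorentzian

namespace MetricCoord

variable {E : Type*} [NormedAddCommGroup E] [NormedSpace ℝ E] [FiniteDimensional ℝ E]
  [CompleteSpace E] {G : E → E →L[ℝ] E →L[ℝ] ℝ} {V : Set E}

omit [FiniteDimensional ℝ E] [CompleteSpace E] in
/-- **Integral curves of a parallel field are geodesics**: if `Dv(X) + Γ(X,v) = 0` on `V` and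
`γ'(s) = v(γ(s))` with `γ(s) ∈ V`, then `(v∘γ)'(s) = −Γ(γ'(s), γ'(s))`.
[cite: ONeill1983, Ch. 3, Def. 3.49] -/
theorem hasDerivAt_field_comp_of_parallel (hVo : IsOpen V) {v : E → E} (hv : ContDiffOn ℝ ∞ v V)
    (hpar : ∀ z ∈ V, ∀ X, fderiv ℝ v z X + chrAt G z X (v z) = 0) {γ : ℝ → E} {s : ℝ}
    (hγV : γ s ∈ V) (hγ : HasDerivAt γ (v (γ s)) s) :
    HasDerivAt (fun t ↦ v (γ t)) (-chrAt G (γ s) (v (γ s)) (v (γ s))) s := by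
  have hvd : DifferentiableAt ℝ v (γ s) :=
    ((hv.contDiffAt (hVo.mem_nhds hγV)).differentiableAt (by simp))
  have h := hvd.hasFDerivAt.comp_hasDerivAt s hγ
  refine h.congr_deriv ?_
  have := hpar (γ s) hγV (v (γ s))
  exact eq_neg_of_add_eq_zero_left this

variable (hG : IsMetricOn G V) {f : E → ℝ} {lam : ℝ} (hf : ContDiffOn ℝ ∞ f V)
  (hsol : ∀ y ∈ V, ∀ u w, ricAt G y u w + hessAt G f y u w = lam * G y u w)
  {v : E → E} (hv : ContDiffOn ℝ ∞ v V)
  (hpar : ∀ z ∈ V, ∀ X, fderiv ℝ v z X + chrAt G z X (v z) = 0)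
  (hunit : ∀ z ∈ V, G z (v z) (v z) = 1) (hnull : ∀ z ∈ V, ∀ Z, ricAt G z (v z) Z = 0)
include hG hf hsol hv hpar hunit hnull

omit hv hpar hunit in
/-- **`S` is constant along the null curves**: `(S∘γ)'(s) = 0` for an integral curve of a unit null
field of a gradient soliton. [cite: PetersenWylie2010, §3] -/
theorem hasDerivAt_scalAt_comp_null_curve {γ : ℝ → E} {s : ℝ} (hγV : γ s ∈ V)
    (hγ : HasDerivAt γ (v (γ s)) s) : HasDerivAt (fun t ↦ scalAt G (γ t)) 0 s := by
  have hSd : DifferentiableAt ℝ (scalAt G) (γ s) :=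
    ((hG.contDiffOn_scalAt.contDiffAt (hG.mem_nhds hγV)).differentiableAt (by simp))
  have h := hasDerivAt_comp_curve (γ := γ) (u := fun t ↦ v (γ t)) hSd hγ
  refine h.congr_deriv ?_
  rw [hG.fderiv_scalAt_of_soliton hγV hf hsol, hG.ricAt_comm hγV, hnull _ hγV, mul_zero]

omit [CompleteSpace E] in
/-- **`(f∘γ)'' = λ` along the null curves**: `(f∘γ)' = df_γ(v∘γ)` and
`(df_γ(v∘γ))' = Hess f(v,v) = λ` (the curve is a geodesic). [cite: PetersenWylie2010, §3]
[cite: ONeill1983, Ch. 3, Def. 3.49] -/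
theorem hasDerivAt_fderiv_comp_null_curve {γ : ℝ → E} {s : ℝ} (hγV : γ s ∈ V)
    (hγ : HasDerivAt γ (v (γ s)) s) :
    HasDerivAt (fun t ↦ f (γ t)) (fderiv ℝ f (γ s) (v (γ s))) s ∧
      HasDerivAt (fun t ↦ fderiv ℝ f (γ t) (v (γ t))) lam s := by
  have hfd : DifferentiableAt ℝ f (γ s) :=
    ((hf.contDiffAt (hG.mem_nhds hγV)).differentiableAt (by simp))
  have hDfd : DifferentiableAt ℝ (fderiv ℝ f) (γ s) :=
    (((hf.contDiffAt (hG.mem_nhds hγV)).fderiv_right (m := ∞) (by simp)).differentiableAt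
      (by simp))
  refine ⟨hasDerivAt_comp_curve (γ := γ) (u := fun t ↦ v (γ t)) hfd hγ, ?_⟩
  have hgeo := hasDerivAt_field_comp_of_parallel hG.isOpen hv hpar hγV hγ
  have h := hasDerivAt_fderiv_geodesic (G := G) (γ := γ) (u := fun t ↦ v (γ t)) hDfd hγ hgeo
  refine h.congr_deriv ?_
  have hs := hsol (γ s) hγV (v (γ s)) (v (γ s))
  rw [hnull _ hγV, hunit _ hγV, zero_add, mul_one] at hs
  exact hs

/-- **The null lines of a degenerate gradient soliton.** Through every `z₀ ∈ V` there is an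
integral curve `γ` of the parallel unit null field on an interval `(−ε, ε)`, `γ(0) = z₀`, which is
a geodesic staying in `V`, along which `S` is constant and `t ↦ df_{γ(t)}(v)` is affine with slope
`λ` (so `f∘γ` is a quadratic polynomial with leading coefficient `λ/2`) — the signature of the
cylinder, where `f = t²/4 + const` along the `ℝ`-factor. [cite: PetersenWylie2010, §3] -/
theorem exists_null_geodesic_scalAt_const_fderiv_affine {z₀ : E} (hz₀ : z₀ ∈ V) :
    ∃ (γ : ℝ → E) (ε : ℝ), 0 < ε ∧ γ 0 = z₀ ∧
      (∀ t ∈ Ioo (-ε) ε, γ t ∈ V ∧ HasDerivAt γ (v (γ t)) t) ∧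
      (∀ t ∈ Ioo (-ε) ε, scalAt G (γ t) = scalAt G z₀) ∧
      ∀ t ∈ Ioo (-ε) ε, fderiv ℝ f (γ t) (v (γ t)) = fderiv ℝ f z₀ (v z₀) + lam * t := by
  -- Picard–Lindelöf
  have hv1 : ContDiffAt ℝ 1 v z₀ :=
    ((hv.contDiffAt (hG.mem_nhds hz₀)).of_le (by exact_mod_cast le_top))
  obtain ⟨γ, hγ0, ε₁, hε₁, hγd⟩ :=
    hv1.exists_forall_mem_closedBall_exists_eq_forall_mem_Ioo_hasDerivAt₀ 0
  simp only [zero_sub, zero_add] at hγd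
  -- shrink the interval so that the curve stays in `V`
  have hγc : ContinuousAt γ 0 := (hγd 0 ⟨by linarith, hε₁⟩).continuousAt
  have hVn : ∀ᶠ t in 𝓝 (0 : ℝ), γ t ∈ V := hγc.preimage_mem_nhds (by rw [hγ0]; exact hG.mem_nhds hz₀)
  obtain ⟨ε₂, hε₂, hε₂V⟩ := Metric.eventually_nhds_iff_ball.mp hVn
  set ε : ℝ := min ε₁ ε₂ with hε
  have hε0 : 0 < ε := lt_min hε₁ hε₂
  have hI : ∀ t ∈ Ioo (-ε) ε, γ t ∈ V ∧ HasDerivAt γ (v (γ t)) t := by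
    intro t ht
    have ht1 : t ∈ Ioo (-ε₁) ε₁ :=
      ⟨lt_of_le_of_lt (neg_le_neg (min_le_left _ _)) ht.1, ht.2.trans_le (min_le_left _ _)⟩
    have ht2 : t ∈ ball (0 : ℝ) ε₂ := by
      rw [mem_ball, dist_zero_right, Real.norm_eq_abs, abs_lt]
      exact ⟨lt_of_le_of_lt (neg_le_neg (min_le_right _ _)) ht.1, ht.2.trans_le (min_le_right _ _)⟩
    exact ⟨hε₂V t ht2, hγd t ht1⟩
  refine ⟨γ, ε, hε0, hγ0, hI, ?_, ?_⟩
  · -- `S ∘ γ` has zero derivative on the interval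
    intro t ht
    have hd : ∀ τ ∈ Ioo (-ε) ε, HasDerivAt (fun t ↦ scalAt G (γ t)) 0 τ := fun τ hτ ↦
      hasDerivAt_scalAt_comp_null_curve hG hf hsol hnull (hI τ hτ).1 (hI τ hτ).2
    have h0 : (0 : ℝ) ∈ Ioo (-ε) ε := ⟨by linarith, hε0⟩
    have hconst := (convex_Ioo (-ε) ε).is_const_of_fderivWithin_eq_zero (𝕜 := ℝ)
      (f := fun t ↦ scalAt G (γ t)) (fun τ hτ ↦ (hd τ hτ).differentiableAt.differentiableWithinAt)
      (fun τ hτ ↦ by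
        rw [fderivWithin_of_isOpen isOpen_Ioo hτ, (hd τ hτ).hasFDerivAt.fderiv]
        simp) ht h0
    rw [hconst, hγ0]
  · -- `t ↦ df(v) − λt` has zero derivative on the interval
    intro t ht
    have hd : ∀ τ ∈ Ioo (-ε) ε,
        HasDerivAt (fun t ↦ fderiv ℝ f (γ t) (v (γ t)) - lam * t) 0 τ := fun τ hτ ↦ by
      have h1 := (hasDerivAt_fderiv_comp_null_curve hG hf hsol hv hpar hunit hnull (hI τ hτ).1
        (hI τ hτ).2).2
      have h2 : HasDerivAt (fun t : ℝ ↦ lam * t) lam τ := by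
        simpa using (hasDerivAt_id τ).const_mul lam
      exact (h1.fun_sub h2).congr_deriv (sub_self lam)
    have h0 : (0 : ℝ) ∈ Ioo (-ε) ε := ⟨by linarith, hε0⟩
    have hconst := (convex_Ioo (-ε) ε).is_const_of_fderivWithin_eq_zero (𝕜 := ℝ)
      (f := fun t ↦ fderiv ℝ f (γ t) (v (γ t)) - lam * t)
      (fun τ hτ ↦ (hd τ hτ).differentiableAt.differentiableWithinAt)
      (fun τ hτ ↦ by
        rw [fderivWithin_of_isOpen isOpen_Ioo hτ, (hd τ hτ).hasFDerivAt.fderiv]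
        simp) ht h0
    simp only [mul_zero, sub_zero, hγ0] at hconst
    linarith

end MetricCoord

end Literature.Geometry.Lorentzian

end
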